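import Literature.NumberTheory.EllipticCurves.GoodReductionUnramifiedProofs
import Literature.NumberTheory.EllipticCurves.ShaRestriction
import Literature.NumberTheory.GaloisRepresentations.ArtinRestriction
import Literature.NumberTheory.EllipticCurves.ZpExtensionProofs
import HarnessLib

/-!
# Potential good reduction: the inertia group of a finite extension acts trivially on the
# prime-to-`v` torsion (Silverman *AEC* VII.4.1(a) after a finite base change), proofs

`Proofs` companion (theorems only, no definitions, no named facts) in topic
`NumberTheory/EllipticCurves`, landed by the tenured seat of bsd.S15
(`Literature.NumberTheory.EllipticCurves.conductorNorm_eq_artinConductorNat`) as the base-change glue under Silverman *ATAEC*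
Thm. IV.10.2(b) (`HasseWeilAbelianConductor`, `HasseWeilAbelianWildInertia`): the printed proofs
of IV.10.2(b)/IV.10.3 and of *AEC* VII.5.4–5.5 pass to a finite extension `K'/K` over which the
curve acquires good reduction and then invoke VII.4.1 *over `K'`* ("the inertia group of `K'`
acts trivially on `E[m]`").  The tree proves VII.4.1 for an elliptic curve over a number field
`K` and the global inertia groups `I_𝔓 ≤ Γ_K` (`WeierstrassCurve.smul_geomPoints_eq_of_mem_inertia`,
file `GoodReductionUnramifiedProofs`); this file transports it along a finite (indeed any
algebraic) extension of number fields `L/K`: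

* `Literature.NumberTheory.EllipticCurves.exists_primesAbove_mem_inertia_iff` — **the inertia group of `L` is `I_𝔓 ∩ Γ_L`**: for
  a prime `𝔓` of `\bar ℤ_K` above `v` there are a place `w ∣ v` of `L` and a prime `𝔔 ∣ w` of
  `\bar ℤ_L` (`𝔔 = ι(𝔓)` for the chosen `ι : K̄ → L̄`, `Literature.NumberTheory.GaloisRepresentations.absClosureEmbedding`, a bijection
  for `L/K` algebraic by the tree's `Literature.NumberTheory.EllipticCurves.absClosureEmbedding_bijective` of `ZpExtensionProofs`,
  mapping `\bar ℤ_K` isomorphically onto `\bar ℤ_L`) with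
  `γ ∈ I_𝔔 ⟺ γ|_{K̄} ∈ I_𝔓` for `γ ∈ Γ_L` (restriction `Literature.absGaloisRestrict K L`; the tree's
  `Literature.NumberTheory.GaloisRepresentations.exists_primesAbove_restrict` of `ArtinRestriction` is the inclusion `res(I_𝔔) ≤ I_𝔓`
  for a prescribed `𝔔`, here one prescribes `𝔓` and gets equality);
* `Literature.NumberTheory.EllipticCurves.absGaloisRestrict_smul_eq_iff` — `γ|_{K̄}` fixes `P ∈ E(K̄)` iff `γ` fixes the image
  of `P` in `E_L(L̄)` (the tree's `Literature.NumberTheory.EllipticCurves.pointsMapOfEmb`, `Literature.NumberTheory.EllipticCurves.localPointsEquivGeomPoints` of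
  `Sha` / `ShaRestriction`, injective and equivariant —
  `Literature.NumberTheory.EllipticCurves.localPointsEquivGeomPoints_pointsMapOfEmb_smul`; the two restriction maps of the tree
  along the chosen embedding, `absGaloisRestrict` and `resGalOfEmb`, agree by
  `resGalOfEmb_eq_of_apply_eq`);
* `WeierstrassCurve.smul_geomPoints_eq_of_mem_inertia_of_baseChange` (and
  `…_of_zsmul_eq_zero`, `…_of_nsmul_eq_zero`) — **if `E` has good reduction at every place of
  `L` above `v`, `v ∤ n`, then every `τ ∈ I_𝔓 ∩ Γ_L` fixes every `P ∈ E(K̄)` with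
  `n (P^τ - P) = O`** (resp. with `n P = O`): VII.4.1(a) for `E/L` at `w`, pulled back;
* `WeierstrassCurve.smul_eq_of_mem_inertia_of_forall_smul_eq_of_nsmul_eq_zero` — the same
  for a finite normal subextension `E ⊆ K̄` and `τ ∈ I_𝔓` restricting trivially to `E`
  (`Γ_E ↠ Gal(K̄/E)` by `Literature.NumberTheory.GaloisRepresentations.exists_mem_range_absGaloisRestrict_iff` and
  `AlgHom.fieldRange_of_normal`).

All axioms `propext`, `Classical.choice`, `Quot.sound`.

## On the rendering

As in `GoodReductionUnramifiedProofs` and `NeronOggShafarevich` (module docstrings): for a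
number field the local statements of *AEC* Ch. VII are rendered with the global inertia groups
`I_𝔓 ≤ Γ_K` of the primes `𝔓` of `\bar ℤ_K` and good reduction of the completion
(`WeierstrassCurve.HasGoodReductionAt`).  A finite extension `K'` of the local field `K_v` is
the completion of a finite extension `L` of `K` at a place `w ∣ v` (Krasner), and the inertia
group of `K'` corresponds to `I_𝔓 ∩ Gal(K̄/L)`; whence the hypothesis "good reduction at every
`w ∣ v`" and the conclusion for `τ ∈ I_𝔓 ∩ Γ_L`.

## References

* [SilvermanAEC2009] J. H. Silverman, *The Arithmetic of Elliptic Curves*, 2nd ed., GTM 106,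
  Springer 2009: Prop. VII.4.1 (PDF p. 173 of the held copy), §VII.5 (potential good reduction,
  Prop. 5.4–5.5), proof of Thm. VII.7.1.
* [SilvermanATAEC1994] J. H. Silverman, *Advanced Topics in the Arithmetic of Elliptic Curves*,
  GTM 151 (1994), proof of Thm. IV.10.2(b) and Prop. IV.10.3 (PDF pp. 359–362).
* [NeukirchANT1999] J. Neukirch, *Algebraic Number Theory*, Springer 1999, Ch. I §9 ((9.4):
  decomposition and inertia groups in subextensions), Ch. II §9 (9.6).
* [SerreLocalFields1979] J.-P. Serre, *Local Fields*, GTM 67, Ch. I §7, Prop. 22.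
-/

noncomputable section

open scoped Classical NumberField
open Field IsDedekindDomain

universe u

namespace Literature.NumberTheory.EllipticCurves

section AbsIntegers

variable (K L : Type u) [Field K] [Field L] [Algebra K L]

/-- An element of `K̄` whose image under `ι : K̄ → L̄` is an absolute integer of `L` (integral
over `𝓞 L`, i.e. over `ℤ`) is an absolute integer of `K`. [folklore] -/
theorem mem_absIntegers_of_absClosureEmbedding_mem {x : AlgebraicClosure K}
    (hx : GaloisRepresentations.absClosureEmbedding K L x ∈ GaloisRepresentations.absIntegers (𝓞 L) L) : x ∈ GaloisRepresentations.absIntegers (𝓞 K) K := by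
  rw [mem_integralClosure_iff] at hx ⊢
  have h1 : IsIntegral ℤ (GaloisRepresentations.absClosureEmbedding K L x) := isIntegral_trans (R := ℤ) (A := 𝓞 L) _ hx
  have h2 : IsIntegral ℤ x :=
    (isIntegral_algHom_iff (GaloisRepresentations.absClosureEmbedding K L).toRingHom.toIntAlgHom
      (GaloisRepresentations.absClosureEmbedding K L).toRingHom.injective).mp h1
  exact h2.tower_top

/-- **Primes and inertia under `Γ_L → Γ_K`, for a prescribed prime of `\bar ℤ_K`.**  Let `L/K`
be an extension of number fields, `v` a finite place of `K` and `𝔓` a prime of `\bar ℤ_K` above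
`v`.  There are a finite place `w` of `L` above `v` and a prime `𝔔` of `\bar ℤ_L` above `w`
(namely `𝔔 = ι(𝔓)` for the chosen isomorphism `ι : K̄ → L̄`, which maps `\bar ℤ_K` onto
`\bar ℤ_L`, and `w = 𝔔 ∩ 𝓞 L`) such that an element `γ ∈ Γ_L` lies in the inertia group `I_𝔔`
if and only if its restriction `γ|_{K̄} ∈ Γ_K` lies in `I_𝔓`: the inertia group of `L` at `𝔔`
is `I_𝔓 ∩ Γ_L`.
Ref: Neukirch, *Algebraic Number Theory*, Ch. I §9, (9.4); Serre, *Local Fields*, I §7,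
Prop. 22. [folklore] -/
theorem exists_primesAbove_mem_inertia_iff [Algebra.IsAlgebraic K L]
    {v : HeightOneSpectrum (𝓞 K)}
    {𝔓 : Ideal (GaloisRepresentations.absIntegers (𝓞 K) K)} (h𝔓 : 𝔓 ∈ v.primesAbove) :
    ∃ (w : HeightOneSpectrum (𝓞 L)) (𝔔 : Ideal (GaloisRepresentations.absIntegers (𝓞 L) L)),
      w.asIdeal.under (𝓞 K) = v.asIdeal ∧ 𝔔 ∈ w.primesAbove ∧
      ∀ γ : absoluteGaloisGroup L,
        γ ∈ 𝔔.inertia (absoluteGaloisGroup L) ↔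
          GaloisRepresentations.absGaloisRestrict K L γ ∈ 𝔓.inertia (absoluteGaloisGroup K) := by
  have hbij := absClosureEmbedding_bijective K L
  -- the map `ιₒ : \bar ℤ_K → \bar ℤ_L`, a `Γ_L`-equivariant ring isomorphism
  let ιo : GaloisRepresentations.absIntegers (𝓞 K) K →+* GaloisRepresentations.absIntegers (𝓞 L) L :=
    ((GaloisRepresentations.absClosureEmbedding K L).toRingHom.comp (GaloisRepresentations.absIntegers (𝓞 K) K).val.toRingHom).codRestrict
      (GaloisRepresentations.absIntegers (𝓞 L) L) (fun x => GaloisRepresentations.absClosureEmbedding_mem_absIntegers K L x)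
  have hιo : ∀ x : GaloisRepresentations.absIntegers (𝓞 K) K,
      ((ιo x : GaloisRepresentations.absIntegers (𝓞 L) L) : AlgebraicClosure L) = GaloisRepresentations.absClosureEmbedding K L x :=
    fun _ => rfl
  have hιo_inj : Function.Injective ιo := fun x y h => by
    apply Subtype.ext
    apply hbij.1
    exact congrArg Subtype.val h
  have hιo_surj : Function.Surjective ιo := fun y => by
    obtain ⟨x, hx⟩ := hbij.2 (y : AlgebraicClosure L)
    exact ⟨⟨x, mem_absIntegers_of_absClosureEmbedding_mem K L (hx ▸ y.2)⟩, Subtype.ext hx⟩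
  have hιo_smul : ∀ (γ : absoluteGaloisGroup L) (x : GaloisRepresentations.absIntegers (𝓞 K) K),
      ιo (GaloisRepresentations.absGaloisRestrict K L γ • x) = γ • ιo x := fun γ x => by
    apply Subtype.ext
    rw [hιo]
    change GaloisRepresentations.absClosureEmbedding K L (GaloisRepresentations.absGaloisRestrict K L γ • (x : AlgebraicClosure K)) =
      γ • GaloisRepresentations.absClosureEmbedding K L x
    exact GaloisRepresentations.absGaloisRestrict_apply_smul K L γ x
  have hιo_alg : ιo.comp (algebraMap (𝓞 K) (GaloisRepresentations.absIntegers (𝓞 K) K)) =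
      (algebraMap (𝓞 L) (GaloisRepresentations.absIntegers (𝓞 L) L)).comp (algebraMap (𝓞 K) (𝓞 L)) := by
    ext r
    change GaloisRepresentations.absClosureEmbedding K L (algebraMap (𝓞 K) (AlgebraicClosure K) r) =
      algebraMap (𝓞 L) (AlgebraicClosure L) (algebraMap (𝓞 K) (𝓞 L) r)
    rw [IsScalarTower.algebraMap_apply (𝓞 K) K (AlgebraicClosure K), AlgHom.commutes,
      IsScalarTower.algebraMap_apply (𝓞 L) L (AlgebraicClosure L),
      ← IsScalarTower.algebraMap_apply (𝓞 K) (𝓞 L) L, IsScalarTower.algebraMap_apply (𝓞 K) K L,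
      ← IsScalarTower.algebraMap_apply K L (AlgebraicClosure L)]
  -- the prime `𝔔 = ιₒ(𝔓)` and the place `w = 𝔔 ∩ 𝓞 L`
  haveI : 𝔓.IsPrime := h𝔓.1
  set 𝔔 : Ideal (GaloisRepresentations.absIntegers (𝓞 L) L) := 𝔓.map ιo with h𝔔def
  have hker : RingHom.ker ιo ≤ 𝔓 := by
    rw [(RingHom.injective_iff_ker_eq_bot ιo).mp hιo_inj]
    exact bot_le
  haveI h𝔔prime : 𝔔.IsPrime := Ideal.map_isPrime_of_surjective hιo_surj hker
  have hcomap : 𝔔.comap ιo = 𝔓 := Ideal.comap_map_of_bijective ιo ⟨hιo_inj, hιo_surj⟩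
  have hunder : (𝔔.under (𝓞 L)).under (𝓞 K) = v.asIdeal := by
    change Ideal.comap (algebraMap (𝓞 K) (𝓞 L))
      (Ideal.comap (algebraMap (𝓞 L) (GaloisRepresentations.absIntegers (𝓞 L) L)) 𝔔) = v.asIdeal
    rw [Ideal.comap_comap, ← hιo_alg, ← Ideal.comap_comap, hcomap]
    exact h𝔓.2.over.symm
  have hne : 𝔔.under (𝓞 L) ≠ ⊥ := by
    intro h
    apply v.ne_bot
    rw [← hunder, h]
    exact Ideal.comap_bot_of_injective _ (NumberField.RingOfIntegers.algebraMap.injective K L)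
  let w : HeightOneSpectrum (𝓞 L) := ⟨𝔔.under (𝓞 L), Ideal.comap_isPrime _ 𝔔, hne⟩
  refine ⟨w, 𝔔, hunder, ⟨h𝔔prime, ⟨rfl⟩⟩, fun γ => ⟨fun hγ x => ?_, fun hγ y => ?_⟩⟩
  · -- `γ ∈ I_𝔔 ⇒ res γ ∈ I_𝔓`
    have h1 : ιo (GaloisRepresentations.absGaloisRestrict K L γ • x - x) ∈ 𝔔 := by
      rw [map_sub, hιo_smul]
      exact hγ (ιo x)
    have h2 : GaloisRepresentations.absGaloisRestrict K L γ • x - x ∈ 𝔔.comap ιo := Ideal.mem_comap.mpr h1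
    rwa [hcomap] at h2
  · -- `res γ ∈ I_𝔓 ⇒ γ ∈ I_𝔔`
    obtain ⟨x, rfl⟩ := hιo_surj y
    rw [← hιo_smul, ← map_sub]
    exact Ideal.mem_map_of_mem ιo (hγ x)

end AbsIntegers

section Points

variable {K : Type u} [Field K] (W : WeierstrassCurve K) (L : Type u) [Field L] [Algebra K L]

/-- **The Galois modules `E(K̄)` and `E_L(L̄)` along `Γ_L → Γ_K`.**  For `P ∈ E(K̄)` and
`γ ∈ Γ_L`: the image in `E_L(L̄)` of `P^{γ|_{K̄}}` is `γ` applied to the image of `P` (along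
the chosen `ι : K̄ → L̄`, `Literature.NumberTheory.EllipticCurves.pointsMapOfEmb`, and the identification `E(L̄) = E_L(L̄)`,
`Literature.NumberTheory.EllipticCurves.localPointsEquivGeomPoints`; the restriction `absGaloisRestrict` of `AbsGaloisGroup` is the
restriction `resGalOfEmb` of `Sha` along the same embedding, `resGalOfEmb_eq_of_apply_eq`).
[folklore] -/
theorem localPointsEquivGeomPoints_pointsMapOfEmb_smul (γ : absoluteGaloisGroup L)
    (P : WeierstrassCurve.geomPoints W) :
    localPointsEquivGeomPoints W L (pointsMapOfEmb W (GaloisRepresentations.absClosureEmbedding K L)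
        (GaloisRepresentations.absGaloisRestrict K L γ • P)) =
      γ • localPointsEquivGeomPoints W L (pointsMapOfEmb W (GaloisRepresentations.absClosureEmbedding K L) P) := by
  have hres : resGalOfEmb (GaloisRepresentations.absClosureEmbedding K L) γ = GaloisRepresentations.absGaloisRestrict K L γ :=
    resGalOfEmb_eq_of_apply_eq _ (GaloisRepresentations.absGaloisRestrict_apply_smul K L γ)
  rw [← localPointsEquivGeomPoints_smul, ← hres, ← pointsMapOfEmb_smul]

/-- For `P ∈ E(K̄)` and `γ ∈ Γ_L`: `γ|_{K̄}` fixes `P` if and only if `γ` fixes the image of `P`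
in `E_L(L̄)` (both comparison maps are injective and equivariant). [folklore] -/
theorem absGaloisRestrict_smul_eq_iff (γ : absoluteGaloisGroup L) (P : WeierstrassCurve.geomPoints W) :
    GaloisRepresentations.absGaloisRestrict K L γ • P = P ↔
      γ • localPointsEquivGeomPoints W L (pointsMapOfEmb W (GaloisRepresentations.absClosureEmbedding K L) P) =
        localPointsEquivGeomPoints W L (pointsMapOfEmb W (GaloisRepresentations.absClosureEmbedding K L) P) := by
  rw [← localPointsEquivGeomPoints_pointsMapOfEmb_smul]
  constructor
  · intro h
    rw [h]
  · intro h
    exact pointsMapOfEmb_injective W _ ((localPointsEquivGeomPoints W L).injective h)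

end Points

end Literature.NumberTheory.EllipticCurves

namespace WeierstrassCurve

open Literature.NumberTheory.GaloisRepresentations Literature.NumberTheory.EllipticCurves

variable {K : Type u} [Field K] (W : WeierstrassCurve K)
variable (L : Type u) [Field L] [NumberField L] [Algebra K L] [Algebra.IsAlgebraic K L]

/-- **Potential good reduction: the inertia group of `L` acts trivially (reduction step).**
Let `E/K` be an elliptic curve over a number field, `L/K` a finite extension over which `E`
has good reduction at every place `w` above the finite place `v` of `K`, `v ∤ n`, `𝔓` a prime of
`\bar ℤ_K` above `v` and `τ ∈ I_𝔓` an element of the inertia group *lying in `Γ_L`* (the image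
of `Gal(L̄/L) → Gal(K̄/K)`), i.e. `τ` in the inertia group of `L` at `𝔓`.  If `P ∈ E(K̄)`
satisfies `n (P^τ - P) = O` then `P^τ = P`.  (Silverman *AEC* VII.4.1 for `E/L` at `w`,
`smul_geomPoints_eq_of_mem_inertia`, transported along `E(K̄) = E_L(L̄)` and
`I_𝔔(L) = I_𝔓 ∩ Γ_L`, `exists_primesAbove_mem_inertia_iff`.)
[cite: SilvermanAEC2009, Prop. VII.4.1(a) and VII.5 (potential good reduction)] -/
theorem smul_geomPoints_eq_of_mem_inertia_of_baseChange [W.IsElliptic]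
    {v : HeightOneSpectrum (𝓞 K)}
    (hgood : ∀ w : HeightOneSpectrum (𝓞 L), w.asIdeal.under (𝓞 K) = v.asIdeal →
      (W.baseChange L).HasGoodReductionAt w)
    {n : ℤ} (hn : (n : 𝓞 K) ∉ v.asIdeal)
    {𝔓 : Ideal (absIntegers (𝓞 K) K)} (h𝔓 : 𝔓 ∈ v.primesAbove)
    {τ : absoluteGaloisGroup K} (hτ : τ ∈ 𝔓.inertia (absoluteGaloisGroup K))
    (hτL : τ ∈ (absGaloisRestrict K L).range)
    {P : geomPoints W} (hP : n • (τ • P - P) = 0) : τ • P = P := by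
  obtain ⟨γ, rfl⟩ := hτL
  change absGaloisRestrict K L γ ∈ _ at hτ
  change n • (absGaloisRestrict K L γ • P - P) = 0 at hP
  change absGaloisRestrict K L γ • P = P
  obtain ⟨w, 𝔔, hw, h𝔔, hI⟩ := exists_primesAbove_mem_inertia_iff K L h𝔓
  have hγ : γ ∈ 𝔔.inertia (absoluteGaloisGroup L) := (hI γ).mpr hτ
  have hnw : (n : 𝓞 L) ∉ w.asIdeal := by
    intro hmem
    apply hn
    have : (n : 𝓞 L) = algebraMap (𝓞 K) (𝓞 L) n := by simp
    rw [this] at hmem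
    rw [← hw, Ideal.under_def, Ideal.mem_comap]
    exact hmem
  have hf : ∀ R : geomPoints W,
      localPointsEquivGeomPoints W L
          (pointsMapOfEmb W (absClosureEmbedding K L) (absGaloisRestrict K L γ • R)) =
        γ • localPointsEquivGeomPoints W L (pointsMapOfEmb W (absClosureEmbedding K L) R) :=
    localPointsEquivGeomPoints_pointsMapOfEmb_smul W L γ
  rw [absGaloisRestrict_smul_eq_iff]
  refine (W.baseChange L).smul_geomPoints_eq_of_mem_inertia (hgood w hw) hnw h𝔔 hγ ?_
  rw [← hf, ← map_sub, ← map_sub, ← map_zsmul, ← map_zsmul, hP, map_zero, map_zero]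

/-- **Potential good reduction: the inertia group of `L` acts trivially on the prime-to-`v`
torsion** (Silverman *AEC* VII.4.1(a) for `E/L`).  With `L/K`, `v ∤ n`, `𝔓 ∣ v` as in
`smul_geomPoints_eq_of_mem_inertia_of_baseChange`: every `τ ∈ I_𝔓 ∩ Γ_L` fixes every
`P ∈ E(K̄)` with `n P = O`. [cite: SilvermanAEC2009, Prop. VII.4.1(a) and VII.5 (potential good reduction)] -/
theorem smul_eq_of_mem_inertia_of_baseChange_of_zsmul_eq_zero [W.IsElliptic]
    {v : HeightOneSpectrum (𝓞 K)}
    (hgood : ∀ w : HeightOneSpectrum (𝓞 L), w.asIdeal.under (𝓞 K) = v.asIdeal →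
      (W.baseChange L).HasGoodReductionAt w)
    {n : ℤ} (hn : (n : 𝓞 K) ∉ v.asIdeal)
    {𝔓 : Ideal (absIntegers (𝓞 K) K)} (h𝔓 : 𝔓 ∈ v.primesAbove)
    {τ : absoluteGaloisGroup K} (hτ : τ ∈ 𝔓.inertia (absoluteGaloisGroup K))
    (hτL : τ ∈ (absGaloisRestrict K L).range)
    {P : geomPoints W} (hP : n • P = 0) : τ • P = P :=
  W.smul_geomPoints_eq_of_mem_inertia_of_baseChange L hgood hn h𝔓 hτ hτL
    (by rw [smul_sub, smul_comm, hP, smul_zero, zero_sub, neg_eq_zero])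

/-- Prop. VII.4.1(a) for `E/L`, natural-number torsion: every `τ ∈ I_𝔓 ∩ Γ_L` fixes every
`P ∈ E(K̄)` with `n P = O`, `v ∤ n`, when `E` has good reduction at the places of `L` above `v`.
[cite: SilvermanAEC2009, Prop. VII.4.1(a) and VII.5 (potential good reduction)] -/
theorem smul_eq_of_mem_inertia_of_baseChange_of_nsmul_eq_zero [W.IsElliptic]
    {v : HeightOneSpectrum (𝓞 K)}
    (hgood : ∀ w : HeightOneSpectrum (𝓞 L), w.asIdeal.under (𝓞 K) = v.asIdeal →
      (W.baseChange L).HasGoodReductionAt w)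
    {n : ℕ} (hn : (n : 𝓞 K) ∉ v.asIdeal)
    {𝔓 : Ideal (absIntegers (𝓞 K) K)} (h𝔓 : 𝔓 ∈ v.primesAbove)
    {τ : absoluteGaloisGroup K} (hτ : τ ∈ 𝔓.inertia (absoluteGaloisGroup K))
    (hτL : τ ∈ (absGaloisRestrict K L).range)
    {P : geomPoints W} (hP : n • P = 0) : τ • P = P :=
  W.smul_eq_of_mem_inertia_of_baseChange_of_zsmul_eq_zero L hgood (n := n) (by exact_mod_cast hn)
    h𝔓 hτ hτL (by rw [natCast_zsmul, hP])

variable {L}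

/-- **Potential good reduction over a finite normal subextension `E ⊆ K̄`: the elements of
`I_𝔓` fixing `E` act trivially on the prime-to-`v` torsion.**  For a finite normal `E/K`
inside `K̄` over which the curve has good reduction at every place above `v`, `v ∤ n`, `𝔓 ∣ v`:
every `τ ∈ I_𝔓` restricting trivially to `E` (i.e. `τ` in the inertia group `I_𝔓 ∩ Gal(K̄/E)`
of `E` at `𝔓`) fixes every `P ∈ E(K̄)` with `n P = O`.  (The image of `Γ_E → Γ_K` is
`Gal(K̄/e(E)) = Gal(K̄/E)` for the induced embedding `e`, `E/K` being normal:
`exists_mem_range_absGaloisRestrict_iff`, `AlgHom.fieldRange_of_normal`.)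
[cite: SilvermanAEC2009, Prop. VII.4.1(a) and VII.5 (potential good reduction)] -/
theorem smul_eq_of_mem_inertia_of_forall_smul_eq_of_nsmul_eq_zero [W.IsElliptic]
    (E : IntermediateField K (AlgebraicClosure K)) [FiniteDimensional K E] [Normal K E]
    [NumberField E]
    {v : HeightOneSpectrum (𝓞 K)}
    (hgood : ∀ w : HeightOneSpectrum (𝓞 E), w.asIdeal.under (𝓞 K) = v.asIdeal →
      (W.baseChange E).HasGoodReductionAt w)
    {n : ℕ} (hn : (n : 𝓞 K) ∉ v.asIdeal)
    {𝔓 : Ideal (absIntegers (𝓞 K) K)} (h𝔓 : 𝔓 ∈ v.primesAbove)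
    {τ : absoluteGaloisGroup K} (hτ : τ ∈ 𝔓.inertia (absoluteGaloisGroup K))
    (hτE : ∀ x : AlgebraicClosure K, x ∈ E → τ • x = x)
    {P : geomPoints W} (hP : n • P = 0) : τ • P = P := by
  have hrange : τ ∈ (absGaloisRestrict K E).range := by
    obtain ⟨e, he⟩ := exists_mem_range_absGaloisRestrict_iff K E
    rw [he]
    intro x
    apply hτE
    have hx : (e x : AlgebraicClosure K) ∈ e.fieldRange := AlgHom.mem_fieldRange.mpr ⟨x, rfl⟩
    rwa [AlgHom.fieldRange_of_normal e] at hx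
  exact W.smul_eq_of_mem_inertia_of_baseChange_of_nsmul_eq_zero E hgood hn h𝔓 hτ hrange hP

end WeierstrassCurve
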